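import Literature.AlgebraicGeometry.ShimuraVarieties.UnitaryShimuraCurveRecord                  -- ★ `RecordSystemGS`, `ShimuraSetGS`, `negCone`, `IsDiagTwistGS`, `recipFactor`, `IsArtinCorrespondent`
import Literature.AlgebraicGeometry.ModuliOfAbelianVarieties.SiegelModuliComplexUniformisation    -- ★ `SiegelFineModuliScheme`, `IsAdmissibleAt`, `siegelPeriodMap`, `typeForm`, `siegelUpperHalfSpace` ((U) currency)
import Literature.AlgebraicGeometry.ModuliOfAbelianVarieties.SiegelFineModuliSchemeExists         -- ★ (F) `lan2013_siegelFineModuliScheme` (PROVED: `Theorems/HCCMUnconditionalSiegelDebtClosers`), `IsQuasiProjectiveOver`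
import Literature.AlgebraicGeometry.AbelianSchemes.AbelianSchemeOverRingAction                   -- ★ `AbelianSchemeOver.RingAction (𝓞 F)`
import Literature.AlgebraicGeometry.AbelianSchemes.AbelianSchemeDualIsogeny                       -- ★ `DualPair.dualIsogenyOver` (Rosati)
import Literature.AlgebraicGeometry.AbelianSchemes.AbelianSchemeFibreHom                          -- ★ `AbelianSchemeOver.fibreHom` (fibre endomorphisms at geometric points)
import Literature.AlgebraicGeometry.Motives.AbelianVarietyCotangent                               -- ★ `AbelianVariety.cotangentMap` ((K-Ω)∕(S-T) currency of A-p17 (g26))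
import Literature.AlgebraicGeometry.ShimuraVarieties.UnitaryCurveSiegelChart                      -- ★ E3 FILE C p846948 `UnitaryCurve.exists_siegelChartGS` (the chart՚s output shape, ED. 2)
import Literature.AlgebraicGeometry.ModuliOfAbelianVarieties.SiegelUniversalFamilyUniformisation  -- ★ P-3 p847075 NAMED FACT `siegelUniversalFamilyUniformisation` (printed letter «UNIV-FAMILY», ED. 2)
import Literature.AlgebraicGeometry.ShimuraVarieties.UnitaryCurveSiegelChartMoverClassified         -- ★ A-p01 p847409 chart + movers + (D3), positivity from `SigDatum` (ED. 4: `stub_E123` PAID)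
import Mathlib.NumberTheory.NumberField.CMField
import Mathlib.NumberTheory.NumberField.InfinitePlace.Embeddings
import HarnessLib

/-!
# `F0P6aPELWitnessEDefs` — ★ RE-HOME (rung-0 re-homing task, books INVENTORY §8.4 M-3) of the E-LINE DEFINITIONS LAYER

This `Theorems/` module is the TREE BYTES of the crux workfile `Summits/HodgeConjecture/HodgeConjecture/Cruxes/HLiu418/Lines/F0_P6a_PELWitnessEDefs.lean`
(edition of record, tree sha16 474c236ce4eebf25, 415 l.) with the NAMESPACE KEPT — `Summit.HodgeConjecture.HodgeConjecture.Cruxes.HLiu418.F0P6aPELWitnessE` —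
so that every fully-qualified name (`GSAdele`, `IsCMTypeThrough`, `mOf`, `AuxChartGS`, `PELWitnessE`, `SigDatum`, `RecordSignatureDatumOfSystem`) is UNCHANGED;
only this module docstring is re-headed.  Why a re-home: a `Theorems/` file cannot import a `Lines/` workfile (F0P6-ref1 o-6), and closing
stmt-HodgeConjecture-24832 `--as proved --by <Theorems decl>` at rung 0 needs the sorry-free Lines chain behind the gate; this layer has NO Lines
import (Tier 0 of the RE-HOME MAP v1.1, LA7-plan (g4) 2026-09-02) and unblocks the E-side chain `SigmaGAL → StubE6 → StubUNIVFAM → PELWitnessE`.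
After this file is ★, the Lines workfile is meant to become a one-import SHIM of it (registrar `crux write`, on word), so no environment ever holds two copies.
It imports ★ `Literature` + Mathlib only; definitions only — NO theorem, NO stub, NO `sorry`; it asserts nothing.

## Original module docstring (verbatim)
# `F0_P6a_PELWitnessEDefs` — the DEFINITIONS LAYER of the E-LINE `F0_P6a_PELWitnessE` (ED. 5 «M-52», variant M-L «layered»; E-pen A-p01 (g27), 2026-09-02)

CRUX `stmt-HodgeConjecture-24832` (HLiu418), sub-line P6a.  This module carries, BYTE-IDENTICAL and under the SAME namespace
`Summit.HodgeConjecture.HodgeConjecture.Cruxes.HLiu418.F0P6aPELWitnessE` (so every fully-qualified name is unchanged), the sorry-free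
DEFINITIONS of the E-line: §1 frames (`GSAdele`, `IsCMTypeThrough`, `mOf`), §2 the chart interface `AuxChartGS`, §3 the socket `PELWitnessE`,
and the two letters `SigDatum` ∕ `RecordSignatureDatumOfSystem` of the registered stub `stub_SIG`.  NO theorem, NO stub, NO `sorry` lives here.

WHY A LAYER (LEAD F0P6-plan (g3) «M-60» (a)(d): closer LEAVES `Lines/F0_P6a_Stub<SOCKET>.lean` per socket).  A closer leaf must see these
definitions (L5՚s `stub_SIG_of_line : RecordSignatureDatumOfSystem`, L6՚s closers over `C : AuxChartGS …`, Σ-GAL), and the E-line must in turn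
IMPORT each written leaf to replace the registered `sorry` BY NAME (`theorem stub_SIG : RecordSignatureDatumOfSystem := F0P6aStubSIG.stub_SIG_of_line`).
With the definitions inside the E-line that is an import cycle; with this layer the DAG is `Defs → leaves → E-line → P-line`, and every importer
of the E-line still receives the definitions transitively.  Precedent: `Lines/F0_P6a_ModuliDatumDefs.lean` under `Lines/F0_P6a_ModuliDatum.lean`.
The architecture, history, registry and all citations of the E-line are in `Lines/F0_P6a_PELWitnessE.lean` (its module docstring is the one of record);
the docstrings below are carried verbatim from ED. 4 (2a1a8134) ∕ ED. 5.
HC_CM is proved only modulo the 2 remaining named inputs (hLiu418 24832, h413 24833) until rung 0 closes; this workfile asserts nothing.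

## References
[cite: Liu2021, App. C §C.1 p. 107; Rem. C.2 p. 108] [cite: RapoportSmithlingZhang2020Diagonal, §3 p. 8, §3.1 p. 8, §4.1 p. 17]
[cite: Milne2005ShimuraVarieties, §8 p. 81, Prop. 13.1 p. 117, Prop. 14.12 p. 125] [cite: Kottwitz1992, §5 pp. 389–391]
[cite: Deligne1971TravauxShimura, Prop. 1.15] [cite: Lan2013PELCompactifications, Thm. 1.4.1.11 (p. 82), Cor. 7.2.3.10 (p. 461)]
-/

set_option autoImplicit false

noncomputable section

namespace Summit.HodgeConjecture.HodgeConjecture.Cruxes.HLiu418.F0P6aPELWitnessE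

set_option linter.dupNamespace false  -- `Summit.HodgeConjecture.HodgeConjecture.…` BY DESIGN (D-0017)

open CategoryTheory CategoryTheory.Limits NumberField IsDedekindDomain MulAction Matrix AlgebraicGeometry
open scoped Matrix ComplexOrder Polynomial
open Literature.AlgebraicGeometry.Motives (SchemeOver AlgPoints ComplexPoints specOver)
open Literature.AlgebraicGeometry.Motives.AbelianVariety (bcSpec)
open Literature.AlgebraicGeometry.AbelianSchemes (PolarizedAbelianSchemeWithLevel AbelianSchemeOver)
open Literature.AlgebraicGeometry.ModuliOfAbelianVarieties
open Literature.AlgebraicGeometry.ShimuraVarieties Literature.AlgebraicGeometry.ShimuraVarieties.UnitaryCanonicalModel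
open Literature.AlgebraicGeometry.HodgeTheory (IsQuasiProjectiveOver)
open Literature.NumberTheory.Automorphic Literature.NumberTheory.Automorphic.UnitaryGroup
open Literature.NumberTheory.Automorphic.Liu2021.AppendixC (C5.OpenCompactSubgroup C5.SmallLevel)

/-! ### §1 Frames: CM types through `ι₁` and the Kottwitz signature they define -/

/-- The finite-adelic points `U(J⋆)(𝔸_{F⁺,f})` of the record՚s group (abbreviation of the ★ carrier). [cite: Liu2021, §C.1 (FJcycle.tex l. 4575–4599)] -/
abbrev GSAdele (F : Type) [Field F] [NumberField F] [IsCMField F] (Jstar : Matrix (Fin 2) (Fin 2) F) : Type :=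
  ↥(finAdelic (↥(maximalRealSubfield F)) F (IsCMField.complexConj F) 2 Jstar)

/-- **A CM type of `F` through `ι₁`**: a set `Φ` of complex embeddings containing `ι₁` and exactly one of each conjugate pair
(`φ ∈ Φ ↔ φ̄ ∉ Φ`).  THE FRAME, chosen per place `w` by GEN (Defs o-8; RSZ՚s auxiliary CM type `Φ`, fixed at the opening of §3). [cite: RapoportSmithlingZhang2020Diagonal, §3 p. 8] -/
def IsCMTypeThrough {F : Type} [Field F] (ι₁ : F →+* ℂ) (Φ : Set (F →+* ℂ)) : Prop :=
  ι₁ ∈ Φ ∧ ∀ φ : F →+* ℂ, φ ∈ Φ ↔ NumberField.ComplexEmbedding.conjugate φ ∉ Φ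

/-- **The Kottwitz signature of the frame `Φ`**: `m φ = 1` on the pair `{ι₁, ῑ₁}` (signature `(1,1)` at the place of `ι₁`), `m φ = 0` on `Φ`
off the pair and `m φ = 2` on `Φᶜ` off the pair (signature `(2,0)`∕`(0,2)` at the definite places, oriented by `Φ`); `∑ m = 2[F⁺:ℚ] = [F:ℚ] = g`.
RSZ՚s generalized CM type `r` for `n = 2` (Remark 3.6 (i) (3.14): `r_{φ₀} = 1`, `r_φ = 0` for `φ ∈ Φ ∖ {φ₀}`, `r_φ̄ = n − r_φ`; the auxiliary signature (3.8)). [cite: RapoportSmithlingZhang2020Diagonal, §3 p. 8, §3.2 (3.8) p. 11, Rem. 3.6 (3.14) p. 13] [cite: Kottwitz1992, §5 p. 390] -/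
def mOf {F : Type} [Field F] (ι₁ : F →+* ℂ) (Φ : Set (F →+* ℂ)) (φ : F →+* ℂ) : ℕ := by
  classical
  exact if φ = ι₁ ∨ φ = NumberField.ComplexEmbedding.conjugate ι₁ then 1 else if φ ∈ Φ then 0 else 2

/-! ### §2 The interface `AuxChartGS` — joint OUTPUT of E1 (aux symplectic module), E2 (period map), E3 (point map) -/

/-- **`AuxChartGS … S Kc Fi τE Φ` — THE AUXILIARY SIEGEL CHART OF THE RECORD CURVE AT LEVEL `Kc`, SLICE FIELD `Fᵢ`, FRAME `Φ`.**
Data and laws, all in ★ currency: (T) a Siegel target `𝓜 : SiegelFineModuliScheme g N δ` (smooth, quasi-projective; `g`, `δ`, `N ≥ 3` chosen by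
E1: `g = [F:ℚ]`, `δ` = elementary divisors of the trace form on the aux lattice, `Kc ⊆ K_δ(N)`) with CHOSEN (U) witnesses `Sc ιc unif` (instantiate
★ `siegelModuli_complexUniformisation_holds`); (P) the point map `f : Sh_{Kc}(U(J⋆), 𝔻)(ℂ) → 𝓜.M(ℂ)` with, per adelic `a`, a piece `piece a` and a
PERIOD FUNCTION `Z a` — entrywise holomorphic on the negative cone, `𝔥_g`-valued, and `f [v, aKc] = ιc (unif (Z a v))` (the rank-2 twin of ★
`HasHolomorphicSiegelLift`; [Deligne1979ShimuraVarieties] 2.3.10: the period point of `((V_ℝ, J_Φ(v)), ψ, aΛ̂)` is holomorphic in `v`); `f` injective on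
the slice; (R) `f_recip`: at the CM pairs `(T_w, [ι₁w])` the Siegel-side action of `σ ∈ Aut(ℂ∕Fᵢ)` follows the unitary reciprocity factor `d`
([Milne2005ShimuraVarieties] (62) on both sides; the aux reflex norm is absorbed by `σ|Fᵢ = 1`); (A) `f_admissible`: the universal triple at
`f [v, aKc]` is admissible for `(Z a v, r)` (★ (U3∃) `IsAdmissibleAt`); (M) the LATTICE READING of the `𝒪_F`-action: `Mρ a : 𝓞 F →+* M_{2g}(ℤ)`
(multiplication by `b` on `Λ_a = F² ∩ aΛ̂` in the symplectic frame of `Z a v`) with `Mρ_kottwitz` (it is `ℂ`-linear for the complex structure of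
`Z a v`, with characteristic polynomial `∏_φ (X − φ b)^{m φ}` on `ℂ^g`, `m = mOf ι₁ Φ`) and `Mρ_rosati` (adjoint of `b̄` for `typeForm δ`).
A data carrier; NOTHING is asserted by declaring it (inhabited by `stub_E123`).
[cite: Deligne1979ShimuraVarieties, 2.3.10] [cite: Milne2005ShimuraVarieties, Thm. 6.11 p. 74 and Def. 12.8 (62) p. 114] [cite: RapoportSmithlingZhang2020Diagonal, Prop. 3.7 (proof) pp. 13–14]
[cite: Kottwitz1992, §5 p. 390] -/
structure AuxChartGS (F : Type) [Field F] [NumberField F] [IsCMField F] (ι₁ : F →+* ℂ) (Jstar : Matrix (Fin 2) (Fin 2) F)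
    (K₀ : C5.OpenCompactSubgroup (GSAdele F Jstar)) (S : RecordSystemGS F Jstar ι₁ K₀) (Kc : C5.SmallLevel K₀)
    (Fi : Type) [Field Fi] [NumberField Fi] [Algebra F Fi] (τE : Fi →+* ℂ) (Φ : Set (F →+* ℂ)) where
  /-- (T) the dimension `g` of the aux abelian varieties (E1: `g = [F:ℚ]`). -/
  g : ℕ
  /-- (T) the full level `N` (E1: `Kc ⊆ K_δ(N)`, `N ≥ 3`). -/
  N : ℕ
  /-- (T) the polarisation type. -/
  δ : Fin g → ℕ
  /-- (T) `0 < g`. -/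
  hg : 0 < g
  /-- (T) `g = [F:ℚ]` (E1). -/
  g_eq : g = Module.finrank ℚ F
  /-- (T) `δ` is a polarisation type. -/
  hδ : IsPolarizationType δ
  /-- (T) `3 ≤ N`. -/
  hN : 3 ≤ N
  /-- (T) the Siegel fine moduli scheme of type `(g, δ, N)` over `ℚ` (★ (F)). -/
  𝓜 : SiegelFineModuliScheme g N δ
  /-- (T) `𝓜.M → Spec ℚ` is smooth (★ (F-c′)). -/
  smooth_M : Smooth 𝓜.M.hom
  /-- (T) `𝓜.M` is quasi-projective over `ℚ` (★ (F-c′); the GAGA target of E4). -/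
  quasiProjective_M : IsQuasiProjectiveOver 𝓜.M
  /-- (D) HODGE-EMBEDDING DATUM (E2): the complex structure `J(v) ∈ S^±` on `V_ℚ = ℚ^{2g}` attached to a negative vector `v` (a-independent; the frame is fixed). -/
  J : (Fin 2 → ℂ) → Matrix (Fin g ⊕ Fin g) (Fin g ⊕ Fin g) ℝ
  /-- (D) `J v ∈ S^±`. -/
  hJ : ∀ v : Fin 2 → ℂ, v ∈ negCone (Jstar.map ι₁) → J v ∈ C0pm δ
  /-- (D) orientation: `−J v ∈ S⁺`. -/
  hJneg : ∀ v : Fin 2 → ℂ, v ∈ negCone (Jstar.map ι₁) → -J v ∈ SiegelModuli.C0 δ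
  /-- (D) `J` depends on the line `ℂv` only. -/
  hJsmul : ∀ c : ℂ, c ≠ 0 → ∀ v : Fin 2 → ℂ, v ∈ negCone (Jstar.map ι₁) → J (c • v) = J v
  /-- (D) HODGE-EMBEDDING DATUM (E1 FILE 5): the group embedding on finite-adelic points `b : U(J⋆)(𝔸_f) → GSp_δ(𝔸_f)` (★ `auxToGspFinV F (·, t₀)`). -/
  b : GSAdele F Jstar →* ↥(gspFinAdelic δ)
  /-- (D) … and on rational points. -/
  bq : ↥(rational (↥(maximalRealSubfield F)) F (IsCMField.complexConj F) 2 Jstar) →* ↥(gspRational δ)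
  /-- (D) `b` and `bq` agree on rational points. -/
  hb : ∀ γ : ↥(rational (↥(maximalRealSubfield F)) F (IsCMField.complexConj F) 2 Jstar),
    b (rationalToFinAdelic (↥(maximalRealSubfield F)) F (IsCMField.complexConj F) 2 Jstar γ) = gspRationalToFinAdelic δ (bq γ)
  /-- (D) equivariance of `J` under rational points (E2 A4). -/
  hJrat : ∀ (γ : ↥(rational (↥(maximalRealSubfield F)) F (IsCMField.complexConj F) 2 Jstar)) (v : Fin 2 → ℂ),
    v ∈ negCone (Jstar.map ι₁) →
      J (((ratToGLℂ F Jstar ι₁ γ : GL (Fin 2) ℂ) : Matrix (Fin 2) (Fin 2) ℂ) *ᵥ v) =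
        conjJ ((gspRationalToReal δ (bq γ) : ↥(gspReal δ)) : GL (Fin g ⊕ Fin g) ℝ) (J v)
  /-- (D) `J` separates lines (E2 A5; input of ★ tower separation). -/
  hJinj : ∀ v : Fin 2 → ℂ, v ∈ negCone (Jstar.map ι₁) → ∀ v' : Fin 2 → ℂ, v' ∈ negCone (Jstar.map ι₁) →
    J v = J v' → ∃ c : ℂ, c ≠ 0 ∧ c • v' = v
  /-- (D) rational points of the image of `b` (E1; input of ★ tower separation). -/
  hbrat : ∀ (γ : ↥(gspRational δ)) (x : GSAdele F Jstar), gspRationalToFinAdelic δ γ = b x →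
    ∃ β : ↥(rational (↥(maximalRealSubfield F)) F (IsCMField.complexConj F) 2 Jstar),
      x = rationalToFinAdelic (↥(maximalRealSubfield F)) F (IsCMField.complexConj F) 2 Jstar β ∧ γ = bq β
  /-- (D) `b` is continuous (★ `continuous_auxToGspFinV`). -/
  hbcont : Continuous b
  /-- (D) the source level sits below the Siegel level: `Kc ≤ b⁻¹(K_δ(N))` (GEN՚s choice of `Kc`∕`N`). -/
  hle : Kc.1.1 ≤ (principalLevelSubgroup δ N).comap b
  /-- (D) THE PERIOD CHART LAW (E2): every `GSp_δ(ℝ)`-translate of `J` that lands in `S⁺` has a holomorphic `𝔥_g`-valued period matrix on the negative cone. -/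
  hZ : ∀ γ : GL (Fin g ⊕ Fin g) ℝ, γ ∈ gspReal δ → (∀ v : Fin 2 → ℂ, v ∈ negCone (Jstar.map ι₁) → conjJ γ (J v) ∈ SiegelModuli.C0 δ) →
    ∃ Z : (Fin 2 → ℂ) → Matrix (Fin g) (Fin g) ℂ,
      (∀ i j : Fin g, DifferentiableOn ℂ (fun v => Z v i j) (negCone (Jstar.map ι₁))) ∧
        ∀ v : Fin 2 → ℂ, v ∈ negCone (Jstar.map ι₁) → Z v ∈ siegelUpperHalfSpace g ∧ conjJ γ (J v) = SiegelModuli.jOfSiegel δ (Z v)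
  /-- (U) the pieces of `𝓜.M ⊗_ℚ ℂ` (★ (U1); FILE C output from here on). -/
  Sc : (ZMod N)ˣ → SchemeOver ℂ
  /-- (U) their inclusions. -/
  ιc : ∀ c, Sc c ⟶ (Literature.AlgebraicGeometry.Motives.baseChange ℚ ℂ).obj 𝓜.M
  /-- (U) the uniformisations `unif_c : 𝔥_g → S_c(ℂ)`. -/
  unif : ∀ c : (ZMod N)ˣ, Matrix (Fin g) (Fin g) ℂ → ComplexPoints (Sc c)
  /-- (U1) the inclusions form a coproduct cofan. -/
  isColimit_ιc : Nonempty (IsColimit (Cofan.mk ((Literature.AlgebraicGeometry.Motives.baseChange ℚ ℂ).obj 𝓜.M) ιc))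
  /-- (U1) the pieces are irreducible. -/
  irreducible : ∀ c, IrreducibleSpace (Sc c).left
  /-- (U2+) `unif_c` is continuous on `𝔥_g` (E4՚s GAGA input — A-p14 (g33)). -/
  unif_cont : ∀ c, ContinuousOn (unif c) (siegelUpperHalfSpace g)
  /-- (U2+) `unif_c` is open on `𝔥_g`. -/
  unif_open : ∀ c, IsOpenMap ((siegelUpperHalfSpace g).restrict (unif c))
  /-- (U2+) `unif_c` is onto. -/
  unif_surj : ∀ c, Set.SurjOn (unif c) (siegelUpperHalfSpace g) Set.univ
  /-- (U2+) the fibres of `unif_c` are the `Γ_δ(N)`-orbits. -/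
  unif_iff : ∀ c, ∀ W ∈ siegelUpperHalfSpace g, ∀ W' ∈ siegelUpperHalfSpace g,
    unif c W = unif c W' ↔ ∃ M ∈ siegelLevelGroup δ N, ∃ C : (Fin g → ℂ) ≃ₗ[ℂ] (Fin g → ℂ),
      ∀ x : Fin g ⊕ Fin g → ℝ, C (siegelPeriodMap δ W x) = siegelPeriodMap δ W' (intAct M x)
  /-- (U2+) `unif_c` is holomorphic in every affine algebraic coordinate. -/
  unif_hol : ∀ (c : (ZMod N)ˣ) (U : (Sc c).left.affineOpens) (s : (Sc c).left.presheaf.obj (Opposite.op (↑U : (Sc c).left.Opens))),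
    DifferentiableOn ℂ (fun Z ↦ AlgPoints.evalOrZero (↑U : (Sc c).left.Opens) s (unif c Z))
      (siegelUpperHalfSpace g ∩ unif c ⁻¹' {P | P.pt ∈ (↑U : (Sc c).left.Opens)})
  /-- (P) THE POINT MAP on the Shimura set of level `Kc`, valued in the `ℚ`-structure points of `𝓜.M`. -/
  f : ShimuraSetGS F Jstar ι₁ Kc.1.1 → ComplexPoints 𝓜.M
  /-- (P) the piece of `𝓜.M ⊗ ℂ` hit by the slice through the adelic representative `a`. -/
  piece : GSAdele F Jstar → (ZMod N)ˣ
  /-- (P) THE PERIOD FUNCTION at the adelic representative `a`. -/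
  Z : GSAdele F Jstar → (Fin 2 → ℂ) → Matrix (Fin g) (Fin g) ℂ
  /-- (P) the units `u_c` of the principal representatives. -/
  u : (ZMod N)ˣ → finAdeleQˣ
  /-- (P) the principal representatives `rep c = diag(1, u_c·1) ∈ K_δ(1)`. -/
  rep : (ZMod N)ˣ → ↥(gspFinAdelic δ)
  /-- (P) the Shimura-set bijection of `(𝓜.M ⊗ ℂ)(ℂ)` at level `K_δ(N)`. -/
  pts : ComplexPoints ((Literature.AlgebraicGeometry.Motives.baseChange ℚ ℂ).obj 𝓜.M) ≃ SiegelShimuraSet δ (principalLevelSubgroup δ N)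
  /-- (P) the five (U3) premisses of the principal representatives. -/
  rep_spec : ∀ c, (∀ w, Valued.v ((u c : finAdeleQ) w) = 1) ∧ (u c : finAdeleQ) - ((c : ZMod N).val : ℕ) ∈ levelIdeal N ∧
    rep c ∈ principalLevelSubgroup δ 1 ∧
      IsMultiplier (typeFormOver δ finAdeleQ) (rep c : GL (Fin g ⊕ Fin g) finAdeleQ) (u c) ∧
        ((rep c : GL (Fin g ⊕ Fin g) finAdeleQ) : Matrix (Fin g ⊕ Fin g) (Fin g ⊕ Fin g) finAdeleQ) =
          Matrix.fromBlocks 1 0 0 ((u c : finAdeleQ) • (1 : Matrix (Fin g) (Fin g) finAdeleQ))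
  /-- (P) `Z a` is entrywise holomorphic on the negative cone of `J⋆^{ι₁}`. -/
  Z_hol : ∀ (a : GSAdele F Jstar) (i j : Fin g), DifferentiableOn ℂ (fun v => Z a v i j) (negCone (Jstar.map ι₁))
  /-- (P) `Z a` is `𝔥_g`-valued on the negative cone. -/
  Z_mem : ∀ (a : GSAdele F Jstar) (v : Fin 2 → ℂ), v ∈ negCone (Jstar.map ι₁) → Z a v ∈ siegelUpperHalfSpace g
  /-- (P) `f [v, aKc] = ιc_{piece a} (unif (Z a v))`, read in the `ℚ`-structure points. -/
  f_mk : ∀ (v : Fin 2 → ℂ) (hv : v ∈ negCone (Jstar.map ι₁)) (a : GSAdele F Jstar),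
    f (ShimuraSetGS.mk F Jstar ι₁ Kc.1.1 v hv a) =
      (AlgPoints.baseChangeEquiv (algebraMap ℚ ℂ) 𝓜.M).symm (AlgPoints.map (ιc (piece a)) (unif (piece a) (Z a v)))
  /-- (P) THE SHIMURA-SET SHADOW: `pts (f [v, aKc]) = [J(v), b(a)]`. -/
  f_pts : ∀ (v : Fin 2 → ℂ) (hv : v ∈ negCone (Jstar.map ι₁)) (a : GSAdele F Jstar),
    pts (AlgPoints.baseChangeEquiv (algebraMap ℚ ℂ) 𝓜.M (f (ShimuraSetGS.mk F Jstar ι₁ Kc.1.1 v hv a))) =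
      SiegelShimuraSet.mk δ (principalLevelSubgroup δ N) ⟨J v, hJ v hv⟩ (b a)
  /-- (P) `[J(v), b(a)] = [J(Z a v), rep (piece a)]`. -/
  f_rep : ∀ (v : Fin 2 → ℂ) (hv : v ∈ negCone (Jstar.map ι₁)) (a : GSAdele F Jstar), ∃ hZv : Z a v ∈ siegelUpperHalfSpace g,
    SiegelShimuraSet.mk δ (principalLevelSubgroup δ N) ⟨J v, hJ v hv⟩ (b a) =
      SiegelShimuraSet.mk δ (principalLevelSubgroup δ N)
        ⟨SiegelModuli.jOfSiegel δ (Z a v), C0_subset_C0pm δ (SiegelModuli.jOfSiegel_mem_C0 hδ.1 hZv)⟩ (rep (piece a))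
  /-- (P) `pts (ιc c (unif c W)) = [J(W), rep c]`. -/
  pts_unif : ∀ (c : (ZMod N)ˣ) (W : Matrix (Fin g) (Fin g) ℂ) (hW : W ∈ siegelUpperHalfSpace g),
    pts (AlgPoints.map (ιc c) (unif c W)) =
      SiegelShimuraSet.mk δ (principalLevelSubgroup δ N)
        ⟨SiegelModuli.jOfSiegel δ W, C0_subset_C0pm δ (SiegelModuli.jOfSiegel_mem_C0 hδ.1 hW)⟩ (rep c)
  /-- (A) SIEGEL FIBRE ADMISSIBILITY AND CLASSIFICATION at the image point ((U3∃) + (U3-D3)): the universal triple at `f [v, aKc]` is admissible for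
  `(Z a v, rep (piece a))`, and EVERY admissible triple over `Spec ℂ` is classified by `f [v, aKc]`. -/
  f_admissible : haveI : IsLocallyNoetherian (specOver ℚ ℂ).left := inferInstanceAs (IsLocallyNoetherian (Spec (CommRingCat.of ℂ)))
    ∀ (v : Fin 2 → ℂ) (hv : v ∈ negCone (Jstar.map ι₁)) (a : GSAdele F Jstar), ∃ hZv : Z a v ∈ siegelUpperHalfSpace g,
    (∃ (P' : PolarizedAbelianSchemeWithLevel g N δ (specOver ℚ ℂ).left)
        (G : P'.A.X.left ⟶ 𝓜.univ.A.X.left) (Ĝ : P'.D.hat.X.left ⟶ 𝓜.univ.D.hat.X.left),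
        P'.IsBaseChangeVia 𝓜.univ (f (ShimuraSetGS.mk F Jstar ι₁ Kc.1.1 v hv a)).left G Ĝ ∧
          IsAdmissibleAt hδ (rep (piece a)) (Z a v) hZv P') ∧
    ∀ P' : PolarizedAbelianSchemeWithLevel g N δ (specOver ℚ ℂ).left, IsAdmissibleAt hδ (rep (piece a)) (Z a v) hZv P' →
      f (ShimuraSetGS.mk F Jstar ι₁ Kc.1.1 v hv a) = 𝓜.classifyingMap (specOver ℚ ℂ) P'
  /-- (A+) THE FULL (U3) JUNCTION on every piece (ED. 5, cure (J1), LEAD 01:18:35Z; A-p04 (g24) memo 007908e8): for every principal representative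
  `(u', r)` of `c` and every `Z ∈ 𝔥_g`, the universal triple at `ιc c (unif c Z)` is admissible for `(Z, r)` and every admissible triple is classified by that
  point (clause (U3) of ★ `siegelModuli_complexUniformisation` for the chart՚s own pieces; the binder `junction` of ★ P-3 ∕ ★ COV-2 ∕ ★ COV-6). -/
  junction : ∀ (c : (ZMod N)ˣ) (u' : finAdeleQˣ) (r : ↥(gspFinAdelic δ)),
    (∀ w, Valued.v ((u' : finAdeleQ) w) = 1) →
    (u' : finAdeleQ) - ((c : ZMod N).val : ℕ) ∈ levelIdeal N →
    r ∈ principalLevelSubgroup δ 1 →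
    IsMultiplier (typeFormOver δ finAdeleQ) (r : GL (Fin g ⊕ Fin g) finAdeleQ) u' →
    ((r : GL (Fin g ⊕ Fin g) finAdeleQ) : Matrix (Fin g ⊕ Fin g) (Fin g ⊕ Fin g) finAdeleQ) =
      Matrix.fromBlocks 1 0 0 ((u' : finAdeleQ) • (1 : Matrix (Fin g) (Fin g) finAdeleQ)) →
    ∀ (W : Matrix (Fin g) (Fin g) ℂ) (hW : W ∈ siegelUpperHalfSpace g),
      haveI : IsLocallyNoetherian (specOver ℚ ℂ).left := inferInstanceAs (IsLocallyNoetherian (Spec (CommRingCat.of ℂ)))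
      (∃ (P' : PolarizedAbelianSchemeWithLevel g N δ (specOver ℚ ℂ).left)
          (G : P'.A.X.left ⟶ 𝓜.univ.A.X.left) (Ĝ : P'.D.hat.X.left ⟶ 𝓜.univ.D.hat.X.left),
          P'.IsBaseChangeVia 𝓜.univ ((AlgPoints.baseChangeEquiv (algebraMap ℚ ℂ) 𝓜.M).symm (AlgPoints.map (ιc c) (unif c W))).left G Ĝ ∧
          IsAdmissibleAt hδ r W hW P') ∧
      (∀ (P' : PolarizedAbelianSchemeWithLevel g N δ (specOver ℚ ℂ).left), IsAdmissibleAt hδ r W hW P' →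
          AlgPoints.map (ιc c) (unif c W) = AlgPoints.baseChangeEquiv (algebraMap ℚ ℂ) 𝓜.M (𝓜.classifyingMap (specOver ℚ ℂ) P'))
  /-- (P+) THE POINT MAP IS INJECTIVE (ED. 5, LEAD «M-52» «SEP AT SATURATED LEVEL»; back from ED. 1: it is TRUE at the `b`-saturated levels
  `Kc ⊓ b⁻¹K_δ(3(k+1)!)`, `k ≥ k₀`, at which ED. 5 produces charts — ★ `UnitaryCurve.exists_forall_le_siegelShadow_separates` ([Deligne1971TravauxShimura]
  Prop. 1.15 at principal level) + ★ `injective_of_shadow_formula` over `f_pts`; it was dropped at ED. 2 only because (α′) promised charts at EVERY small level). -/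
  f_injective : Function.Injective f
  /-- (R) CM RECIPROCITY COMPATIBILITY (E5՚s input): for `σ ∈ Aut(ℂ∕Fᵢ)` with Artin correspondent `s`, at the CM pair of `w ∈ F²` with twist `d`,
  `σ • f [ι₁w, a] = f [ι₁w, d·a]`. -/
  f_recip : letI : Algebra Fi ℂ := τE.toAlgebra
    ∀ (σ : ℂ ≃ₐ[Fi] ℂ) (s : (FiniteAdeleRing (𝓞 F) F)ˣ), IsArtinCorrespondent F ι₁ s σ.toRingEquiv →
      ∀ (w : Fin 2 → F) (hw : (fun i => ι₁ (w i)) ∈ negCone (Jstar.map ι₁)) (d : GSAdele F Jstar),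
        IsDiagTwistGS F Jstar w (recipFactor F s) d →
        ∀ a : GSAdele F Jstar,
          (σ.restrictScalars ℚ) • f (ShimuraSetGS.mk F Jstar ι₁ Kc.1.1 (fun i => ι₁ (w i)) hw a) =
            f (ShimuraSetGS.mk F Jstar ι₁ Kc.1.1 (fun i => ι₁ (w i)) hw (d * a))
  /-- (M-fr) THE FRAME READING (ED. 5, A-p15 (g18) 01:26:26Z, A-p06 «=»): the INTEGRAL representation `ρ₀ : 𝒪_F → M_{2g}(ℤ)` of the frame lattice (★ 7b
  `exists_symplecticFrameV_integralAction`), common to all adelic representatives; pinned to the CM structure of the special points by `cm_recip` and to the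
  lattice readings by `Mρ_frame`. -/
  ρ₀ : 𝓞 F →+* Matrix (Fin g ⊕ Fin g) (Fin g ⊕ Fin g) ℤ
  /-- (R+) THE CM DATUM AT THE SPECIAL POINTS (ED. 5, «L6» LA6-p01 (g0) 02:02Z∕02:11Z; the `hsp hE σ s hs r hr` block of ★ `cmConjugationIsogenyAll_holds` BY VALUE
  at `J(ι₁ w)`, + the two class identities): for `σ ∈ Aut(ℂ∕Fᵢ)` with Artin correspondent `s`, the CM pair of `w` with twist `d`, and every adelic `a`: a slice field
  `E` FIXED by `σ`, a CM structure `c` SPECIAL for `J(ι₁ w)` with types `Φ′`, `E*(Φ′ᵢ) ⊆ E`, an Artin correspondent `sE` of `σ` over `E`, the reciprocity element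
  `r = c.cmRecipMatrix Φ′ E sE`, and `d′` with `r·b a ∈ b(d′a)·K_δ(N)` (explicit `t`, LA6-p02 v4 text) and `[ι₁w, d a]_{K′} = [ι₁w, d′a]_{K′}`, the CM structure
  `c` PINNED to the frame reading `ρ₀` (`ρ₀(x) = c.actMatrix x`, so the reciprocity element commutes with the lattice readings via `Mρ_frame`) — without it the
  Σ-GAL socket of `stub_E6` has no CM structure at the abstract `C.J` (LA6-p01 finding (3), LA6-p02 (F-lin)); `f_recip` is its corollary (★ `smul_f_mk_eq_of_cmDatum`).
  PAID AT BIRTH by ★ `exists_sliceField_f_recip_cmDatum_pinned` (E3R-U ED. 3 `…_pinned` + E3R-S). -/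
  cm_recip : letI : Algebra Fi ℂ := τE.toAlgebra
    ∀ (σ : ℂ ≃ₐ[Fi] ℂ) (s : (FiniteAdeleRing (𝓞 F) F)ˣ), IsArtinCorrespondent F ι₁ s σ.toRingEquiv →
      ∀ (w : Fin 2 → F) (hw : (fun i => ι₁ (w i)) ∈ negCone (Jstar.map ι₁)) (d : GSAdele F Jstar),
        IsDiagTwistGS F Jstar w (recipFactor F s) d →
        ∀ a : GSAdele F Jstar,
          ∃ (E : IntermediateField ℚ ℂ) (_ : NumberField ↥E) (c : CMStructure g δ (Fin 2) (fun _ => F))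
            (Φ' : Fin 2 → Literature.AlgebraicGeometry.Motives.CMType F)
            (sE : (FiniteAdeleRing (𝓞 ↥E) ↥E)ˣ) (r : ↥(gspFinAdelic δ)) (d' : GSAdele F Jstar),
            c.IsSpecial ⟨J (fun i => ι₁ (w i)), hJ _ hw⟩ Φ' ∧
            (∀ x : 𝓞 F, (ρ₀ x).map (Int.cast : ℤ → ℚ) = c.actMatrix (fun _ => ((x : 𝓞 F) : F))) ∧
            (∀ i, Literature.NumberTheory.ComplexMultiplication.traceField (Φ' i) ≤ E) ∧
            (∀ x : ℂ, x ∈ E → (σ.restrictScalars ℚ) x = x) ∧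
            IsArtinCorrespondent ↥E (algebraMap ↥E ℂ) sE (σ.restrictScalars ℚ).toRingEquiv ∧
            ((r : GL (Fin g ⊕ Fin g) finAdeleQ) : Matrix (Fin g ⊕ Fin g) (Fin g ⊕ Fin g) finAdeleQ) = c.cmRecipMatrix Φ' E sE ∧
            (∃ t ∈ principalLevelSubgroup δ N, r * b a = b (d' * a) * t) ∧
            ∀ K' : Subgroup (GSAdele F Jstar),
              ShimuraSetGS.mk F Jstar ι₁ K' (fun i => ι₁ (w i)) hw (d * a) = ShimuraSetGS.mk F Jstar ι₁ K' (fun i => ι₁ (w i)) hw (d' * a)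
  /-- (Q) THE RATIONAL MOVERS (★ E3 FILE D `exists_siegelChartGS_mover`): `q a ∈ GSp_δ(ℚ)`, chosen once per adelic representative `a`. -/
  q : GSAdele F Jstar → ↥(gspRational δ)
  /-- (Q) THE MOVER LAW (★ FILE D clause (Q) VERBATIM): on the negative cone `(q a)_ℝ⁻¹ J(v) (q a)_ℝ = J(Z a v)`, and `(q a)_𝔸 · rep (piece a) K_δ(N) = b(a) K_δ(N)`
  (so the marking of the image point is the `q a`-translate of the frame: `Mρ a = (q a)⁻¹ ρ (q a)` in ★ `exists_chartActionReading_kottwitz`). -/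
  q_spec : ∀ (v : Fin 2 → ℂ), v ∈ negCone (Jstar.map ι₁) → ∀ a : GSAdele F Jstar,
    conjJ (((gspRationalToReal δ (q a))⁻¹ : ↥(gspReal δ)) : GL (Fin g ⊕ Fin g) ℝ) (J v) = SiegelModuli.jOfSiegel δ (Z a v) ∧
      gspRationalToFinAdelic δ (q a) • ((rep (piece a) : ↥(gspFinAdelic δ)) : ↥(gspFinAdelic δ) ⧸ principalLevelSubgroup δ N) =
        ((b a : ↥(gspFinAdelic δ)) : ↥(gspFinAdelic δ) ⧸ principalLevelSubgroup δ N)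
  /-- (M) THE LATTICE READING of the `𝒪_F`-action at the adelic representative `a`: `b ↦` the matrix of `b` on `Λ_a` in the symplectic frame. -/
  Mρ : GSAdele F Jstar → (𝓞 F →+* Matrix (Fin g ⊕ Fin g) (Fin g ⊕ Fin g) ℤ)
  /-- (M) KOTTWITZ: `Mρ a b` is `ℂ`-linear for the complex structure of `Z a v` (it commutes with the period map) and its `ℂ`-linear avatar on
  `ℂ^g = Lie` has characteristic polynomial `∏_φ (X − φ b)^{m φ}`, `m = mOf ι₁ Φ`. -/
  Mρ_kottwitz : ∀ (a : GSAdele F Jstar) (v : Fin 2 → ℂ), v ∈ negCone (Jstar.map ι₁) → ∀ b : 𝓞 F,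
    ∃ Cb : (Fin g → ℂ) →ₗ[ℂ] (Fin g → ℂ),
      (∀ u : Fin g ⊕ Fin g → ℝ,
          Cb (siegelPeriodMap δ (Z a v) u) = siegelPeriodMap δ (Z a v) (((Mρ a b).map (Int.cast : ℤ → ℝ)) *ᵥ u)) ∧
      Cb.charpoly = ∏ φ : F →+* ℂ, (Polynomial.X - Polynomial.C (φ (b : F))) ^ (mOf ι₁ Φ φ)
  /-- (M) ROSATI (orientation provisional): `Mρ a b̄` is the `typeForm δ`-adjoint of `Mρ a b`. -/
  Mρ_rosati : ∀ (a : GSAdele F Jstar) (b b' : 𝓞 F), (b' : F) = (IsCMField.complexConj F) (b : F) →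
    (Mρ a b')ᵀ * typeForm δ = typeForm δ * Mρ a b
  /-- (M-fr) THE FRAME LAW: on the cone every lattice reading is the RATIONAL CONJUGATE of the frame reading by the mover, `Mρ a b = (q a)⁻¹ ρ₀(b) (q a)` — the
  cross-representative relation the per-`a` laws (K)(R)(M-eq) cannot supply (Σ-GAL `hℓ`, ★ `SiegelAdelicCongrFrameTransport`); clause (fr) of ★
  `UnitaryCurve.AuxV.exists_chartActionReading_frame` VERBATIM. -/
  Mρ_frame : ∀ (v : Fin 2 → ℂ), v ∈ negCone (Jstar.map ι₁) → ∀ (a : GSAdele F Jstar) (b : 𝓞 F),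
    (Mρ a b).map (Int.cast : ℤ → ℚ) =
      ((((q a)⁻¹ : ↥(gspRational δ)) : GL (Fin g ⊕ Fin g) ℚ) : Matrix (Fin g ⊕ Fin g) (Fin g ⊕ Fin g) ℚ) * (ρ₀ b).map (Int.cast : ℤ → ℚ) *
        (((q a : ↥(gspRational δ)) : GL (Fin g ⊕ Fin g) ℚ) : Matrix (Fin g ⊕ Fin g) (Fin g ⊕ Fin g) ℚ)
  /-- (D-lin) THE FRAME READING IS `U(J⋆)(F⁺)`-LINEAR (ED. 5, A-p15 (g18) 01:26:26Z ∕ (g19) 02:32:26Z; LA6-r01 #0b + LAref-E L6 #2 GREEN as a FIELD): the rational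
  Hodge embedding of every rational point commutes with the frame reading of scalars — the cross-representative input of Σ-GAL∕Σ-AN (two representatives of one
  point have period frames related by `(q a′)⁻¹ (bq γ) (q a)`; ★ ONE-CALL `exists_cmConjHom_kernelShape_frame_of_forall_mem_apply_eq` consumes `hM₂ : M₂ b = q₂⁻¹ ρ₀ q₂`
  at the twist).  Over the abstract chart nothing else links `bq` to `ρ₀`; at birth it is ★ `UnitaryCurve.AuxV.map_intCast_reading_mul_coe_auxRepV_comm` at `R := ℚ`
  (the reading commutes with the WHOLE carrier `auxRepV ℚ Fr`). [cite: Milne2005ShimuraVarieties, §8 p. 81] [cite: Kottwitz1992, §5 p. 390] -/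
  bq_comm_ρ₀ : ∀ (γ : ↥(rational (↥(maximalRealSubfield F)) F (IsCMField.complexConj F) 2 Jstar)) (b : 𝓞 F),
    (((bq γ : ↥(gspRational δ)) : GL (Fin g ⊕ Fin g) ℚ) : Matrix (Fin g ⊕ Fin g) (Fin g ⊕ Fin g) ℚ) * (ρ₀ b).map (Int.cast : ℤ → ℚ) =
      (ρ₀ b).map (Int.cast : ℤ → ℚ) * (((bq γ : ↥(gspRational δ)) : GL (Fin g ⊕ Fin g) ℚ) : Matrix (Fin g ⊕ Fin g) (Fin g ⊕ Fin g) ℚ)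
  /-- (M-eq) PERIOD EQUIVARIANCE WITH `Mρ`-COMMUTING LEVEL MONODROMY (E6 owner A-p06 (g32), MEMO 07c2eec7 §1 VERBATIM; ★ `RecordSystemGS.pieces`
  currency `arithmeticLevel`, ★ (U2+) lattice form): for `γ` in the arithmetic level of `Kc` at the representative `a` and `γ^{ι₁} v = c • v'` on the negative
  cone, the period points `Z a v`, `Z a v'` differ by an INTEGRAL `M ∈ Γ_δ(N)` (with its `ℂ`-linear part `L`) that COMMUTES with every `Mρ a b` — without it
  `stub_E6` is not derivable (monodromy obstruction); supplied by ★ `UnitaryCurveAuxiliaryPeriodLevelTransport` (A-p17 (g27)) over ★ FILE 8∕9. -/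
  Z_equivariant : ∀ (a : GSAdele F Jstar) (γ : GL (Fin 2) F),
    γ ∈ arithmeticLevel (↥(maximalRealSubfield F)) F (IsCMField.complexConj F) 2 Jstar (Kc.1.1.map (MulAut.conj a).toMonoidHom) →
    ∀ (v : Fin 2 → ℂ), v ∈ negCone (Jstar.map ι₁) → ∀ (v' : Fin 2 → ℂ), v' ∈ negCone (Jstar.map ι₁) →
    ∀ c : ℂ, c ≠ 0 → ((γ : Matrix (Fin 2) (Fin 2) F).map ι₁) *ᵥ v = c • v' →
    ∃ M ∈ siegelLevelGroup δ N, ∃ L : (Fin g → ℂ) ≃ₗ[ℂ] (Fin g → ℂ),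
      (∀ w : Fin g ⊕ Fin g → ℝ, L (siegelPeriodMap δ (Z a v) w) = siegelPeriodMap δ (Z a v') (intAct M w)) ∧
      ∀ b : 𝓞 F, (M : Matrix (Fin g ⊕ Fin g) (Fin g ⊕ Fin g) ℤ) * Mρ a b = Mρ a b * M

/-! ### §3 The socket `PELWitnessE` (scoping memo §1: (S5)(S6)(S7 at ℂ-points)) over `X := (S.M Kc) ⊗_F Fᵢ` -/

/-- **`PELWitnessE … S Kc Fi τE Φ` — THE PEL TUPLE ON THE THICKENED RECORD CURVE**: a polarised abelian scheme with full level-`N` structure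
`P` over `X := (S.M Kc) ⊗_F Fᵢ` of relative dimension `g = [F:ℚ]` (S5), an `𝒪_F`-action `ρ` (S6) satisfying ROSATI against `P.pol` (S6-R), and
KOTTWITZ AT EVERY COMPLEX POINT of `X` (along `τE`) with the signature `mOf ι₁ Φ` (S7 at ℂ-points, ★ `cotangentMap` ∘ ★ `fibreHom` currency =
A-p17 (g26)՚s (K-Ω)).  Consumed by `stub_RGD` (spread to `𝓨`, (U1-c) closedness for `Ω`-points, (U1-d) count).  A data carrier; nothing asserted.
[cite: RapoportSmithlingZhang2020Diagonal, §4.1 p. 17] [cite: Kottwitz1992, §5 pp. 389–391] -/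
structure PELWitnessE (F : Type) [Field F] [NumberField F] [IsCMField F] (ι₁ : F →+* ℂ) (Jstar : Matrix (Fin 2) (Fin 2) F)
    (K₀ : C5.OpenCompactSubgroup (GSAdele F Jstar)) (S : RecordSystemGS F Jstar ι₁ K₀) (Kc : C5.SmallLevel K₀)
    (Fi : Type) [Field Fi] [NumberField Fi] [Algebra F Fi] (τE : Fi →+* ℂ) (Φ : Set (F →+* ℂ)) where
  /-- (S5) dimension. -/
  g : ℕ
  /-- (S5) full level. -/
  N : ℕ
  /-- (S5) polarisation type. -/
  δ : Fin g → ℕ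
  /-- (S5) `δ` is a polarisation type, `N ≥ 3`. -/
  hδN : IsPolarizationType δ ∧ 3 ≤ N
  /-- (S5) the tuple `(A, Â, 𝒫, λ, η)` over `X`. -/
  P : PolarizedAbelianSchemeWithLevel g N δ ((Literature.AlgebraicGeometry.Motives.baseChange F Fi).obj (S.M.obj Kc)).left
  /-- (S5) `g = [F:ℚ]` (⇒ `hgF : univ.IsOfRelDim (finrank ℚ F)` by `P.relDim`). -/
  hg : g = Module.finrank ℚ F
  /-- (S8) PROVENANCE (ED. 5): the Siegel fine moduli scheme of the chart (door (E)). -/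
  𝓜 : SiegelFineModuliScheme g N δ
  /-- (S8) PROVENANCE (ED. 5): the SLICE MORPHISM `ε : X = (S.M Kc) ⊗_F Fᵢ ⟶ 𝓜.M ⊗_ℚ Fᵢ` (E5) along which `P` is pulled back. -/
  ε : (Literature.AlgebraicGeometry.Motives.baseChange F Fi).obj (S.M.obj Kc) ⟶
    (Literature.AlgebraicGeometry.Motives.baseChange ℚ Fi).obj 𝓜.M
  /-- (S8) PROVENANCE (ED. 5): the comparison of abelian schemes `P.A ⟶ 𝓜.univ.A` over `ε`. -/
  G : P.A.X.left ⟶ 𝓜.univ.A.X.left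
  /-- (S8) PROVENANCE (ED. 5): the comparison of dual abelian schemes over `ε`. -/
  Ĝ : P.D.hat.X.left ⟶ 𝓜.univ.D.hat.X.left
  /-- (S8) PROVENANCE (ED. 5): `P = ε^* 𝓜.univ` (★ `PolarizedAbelianSchemeWithLevel.IsBaseChangeVia`). -/
  isBaseChange : P.IsBaseChangeVia 𝓜.univ (ε.left ≫ pullback.fst 𝓜.M.hom (bcSpec ℚ Fi)) G Ĝ
  /-- (S8) SEPARATION `sep` (ED. 5, LEAD «M-47»∕«M-52»): `ε` is INJECTIVE ON COMPLEX POINTS along `τE` ([Deligne1971TravauxShimura] Prop. 1.15 at the `b`-saturated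
  level: `AuxChartGS.f_injective` ★ p847628 + ★ `RecordSystemGS.algPoints_map_injective_of_sliceDescent` p847435); the `Ω̄_w`-point form `ESepAt` of the P-line
  is its transport ★ `Motives.algPoints_map_injective_of_injective_algPoints` (p847641, `ε` separated, source projective). -/
  sep : letI : Algebra Fi ℂ := τE.toAlgebra
    Function.Injective
      (AlgPoints.map ε : ComplexPoints ((Literature.AlgebraicGeometry.Motives.baseChange F Fi).obj (S.M.obj Kc)) →
        ComplexPoints ((Literature.AlgebraicGeometry.Motives.baseChange ℚ Fi).obj 𝓜.M))
  /-- (S6) the `𝒪_F`-action. -/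
  ρ : AbelianSchemeOver.RingAction (𝓞 F) P.A
  /-- (S6-R) ROSATI: `λ ∘ ι(b̄) = ι(b)^∨ ∘ λ` (diagrammatic `ι(b̄) ≫ λ = λ ≫ ι(b)^∨`). -/
  rosati : ∀ (b b' : 𝓞 F), (b' : F) = (IsCMField.complexConj F) (b : F) →
    haveI := ρ.isMonHom b
    ρ.i b' ≫ P.pol.lam = P.pol.lam ≫ AbelianSchemeOver.DualPair.dualIsogenyOver (ρ.i b) P.D P.D
  /-- (S7 at ℂ-points) KOTTWITZ: at every complex point `x` of `X` (along `τE`), `ι(b)` acts on the cotangent space of the fibre with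
  characteristic polynomial `∏_φ (X − φ b)^{mOf ι₁ Φ φ}`. -/
  kottwitz : letI : Algebra Fi ℂ := τE.toAlgebra
    ∀ (x : ComplexPoints ((Literature.AlgebraicGeometry.Motives.baseChange F Fi).obj (S.M.obj Kc))) (b : 𝓞 F),
      haveI := ρ.isMonHom b
      (Literature.AlgebraicGeometry.Motives.AbelianVariety.cotangentMap (P.A.fibre x.left).toAbelianVariety
          (AbelianSchemeOver.fibreHom (ρ.i b) x.left)).charpoly =
        ∏ φ : F →+* ℂ, (Polynomial.X - Polynomial.C (φ (b : F))) ^ (mOf ι₁ Φ φ)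

/-! ### §0a The letters of the registered stub `stub_SIG` (its `sorry` lives in the E-line) -/

/-- **The SIGNATURE DATUM of `(F, ι₁, J⋆)`** (LEAD heir F0P6-plan (g3) «M-42» (a) on A-p17 (g27)՚s POSITIVITY-GAP MEMO 6423536d; a LOCAL letter until
A-p17՚s ★ organ `UnitarySignatureDatum` lands, then re-pointed BY NAME): a rescaling `t • J⋆` by a TOTALLY POSITIVE-at-`ι₁` real `t` which has signature `(1,1)`
at `ι₁` (a frame `T` with `Tᴴ (t•J⋆)^{ι₁} T = diag(1, −1)`) and is DEFINITE at every other infinite place — exactly the hypotheses `hT`∕`hpos` of the E2 chart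
(★ `exists_siegelChartGS_auxComplexStructureV_mover`), which the signature-free prefix of the P6 letters (`CorD9OnMOp` … `stub_E123`) does not carry.
Print: «positive definite away from `ι₁`» is LIU՚s normalisation («signature `(n − 1, 1)` at `τ` and `(n, 0)` at other places», Rem. C.2); RSZ print the
opposite one (`(0, n)` elsewhere, §3.1 p. 8; Rem. 3.6 (ii) p. 13 «if one took the opposite signatures … no sign would be needed»); at `ι₁` both read `(1,1)` for `n = 2`.
[cite: Liu2021, App. C §C.1 p. 107 ((p_τ, q_τ)); Rem. C.2 p. 108 (signature (n−1,1) at τ, (n,0) elsewhere)]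
[cite: RapoportSmithlingZhang2020Diagonal, §3.1 p. 8 (signatures of W at the archimedean places); cf. Rem. 3.6 (ii) p. 13] -/
def SigDatum (F : Type) [Field F] [NumberField F] [IsCMField F] (ι₁ : F →+* ℂ) (Jstar : Matrix (Fin 2) (Fin 2) F) : Prop :=
  ∃ t : F, 0 < (ι₁ t).re ∧ (ι₁ t).im = 0 ∧
    (∃ T : GL (Fin 2) ℂ, ((T : GL (Fin 2) ℂ) : Matrix (Fin 2) (Fin 2) ℂ)ᴴ * (t • Jstar).map ι₁ * (T : Matrix (Fin 2) (Fin 2) ℂ) =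
      Literature.AlgebraicGeometry.ShimuraVarieties.signatureMatrix 1) ∧
    ∀ σ : F →+* ℂ, NumberField.InfinitePlace.mk σ ≠ NumberField.InfinitePlace.mk ι₁ → ((t • Jstar).map σ).PosDef

/-- **The letter of `stub_SIG`: every letter context of the E-line (record system `S` for `(F, ι₁, J⋆)`, `J⋆` hermitian invertible, small level) carries
a signature datum** — «M-42» (a): the binder prefix of `stub_E123` VERBATIM, conclusion `SigDatum F ι₁ Jstar`.  Books row «SIG — signature datum of the
record system, UNPROVED-INHOUSE» (exit E1: pay it from the record system՚s (F1)–(F3) by vacuity ∕ Borel density; exit E2: registry reshape threading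
the group through the P6 letters, after which this stub is deleted).
(print: Liu2021, App. C §C.1 p. 107 ((p_τ, q_τ)); Rem. C.2 p. 108 (signature (n−1,1) at τ, (n,0) elsewhere))
(print: RapoportSmithlingZhang2020Diagonal, §3.1 p. 8 (signatures of W at the archimedean places); cf. Rem. 3.6 (ii) p. 13) -/
def RecordSignatureDatumOfSystem : Prop :=
  ∀ (F : Type) [Field F] [NumberField F] [IsCMField F] [IsGalois ℚ F] (ι₁ : F →+* ℂ)
    (Jstar : Matrix (Fin 2) (Fin 2) F) (_hJ : (Jstar.map (IsCMField.complexConj F))ᵀ = Jstar) (_hJu : IsUnit Jstar)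
    (K₀ : C5.OpenCompactSubgroup (GSAdele F Jstar)) (_S : RecordSystemGS F Jstar ι₁ K₀) (_Kc : C5.SmallLevel K₀),
    SigDatum F ι₁ Jstar

end Summit.HodgeConjecture.HodgeConjecture.Cruxes.HLiu418.F0P6aPELWitnessE

end
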